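import Literature.NumberTheory.GaloisRepresentations.TateUnramifiedLiftingReductionProofs
import Literature.NumberTheory.GaloisRepresentations.TateLevelOneTwo
import Literature.NumberTheory.GaloisCohomology.BrauerHassePrincipleHolds
import HarnessLib

/-!
# Tate's lifting theorems for projective representations of `G_ℚ`: the discharges
# (Serre, Durham 1977, §6.1 Cor. to Thm. 4 and §6.2 Thm. 5)

Fourth sibling *proofs* file of `TateProjectiveLifting.lean` (theorems only: no definition, no
named fact, no instance; D-0026).  It closes the two named facts of that file:

* `Tate_projectiveLifting_holds` — **Tate's lifting theorem** (Serre, *Modular forms of weight one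
  and Galois representations*, Durham 1977, §6.1, Corollary to Theorem 4 (Tate): every projective
  representation `ρ̃ : G_ℚ → PGL_n(k)` with open kernel, `k` algebraically closed with the discrete
  topology, lifts to a continuous `ρ : G_ℚ → GL_n(k)`).  The printed proof (§6.1 "Theorem 4 ⟹
  Corollary"; §6.5, proof of Theorem 4 `H²(G_K, ℚ/ℤ) = 0`: (a) reduction to one prime `p` and to
  `K ⊇ μ_p`, (b) the local case, (c) the global case — "an element `α ∈ Br_p(K)` is described by its
  local components", then idele class characters with prescribed restrictions to the `μ_{p,v}`) is
  formalized across the tree's `TateProjectiveLiftingH2Proofs.lean`, `TateH2Vanishing*.lean`,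
  `TateLocalH2*.lean` and `TateLevelOne*.lean`, ending in
  `Tate_projectiveLifting_of_brauerHassePrinciple'` (`TateLevelOneTwo.lean`), whose only inputs are
  the Hasse principle for the Brauer groups of `ℚ(μ_p)` (`p` odd) and of `ℚ(i)`; that input is the
  theorem `Literature.NumberTheory.GaloisCohomology.brauerHassePrinciple_holds`
  (Brauer–Hasse–Noether, from Hasse's norm theorem for cyclic extensions; Cassels–Fröhlich Ch. VII
  §9.6, §10).
* `Tate_projectiveLifting_unramifiedOutside_holds` — **lifting with the same ramification**
  (§6.2 Thm. 5 with the Exercise of §6.1; Bosman 2011, Thm. 7.2.2 with Lemma 7.2.3: if `ρ̃` is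
  unramified outside a finite set `S` of primes, some lifting is unramified outside `S`).  The
  printed proof of Thm. 5 (twist a lifting `ρ₁` by an idele class character `χ` of `ℚ` with
  `χ|I_p = χ_p|I_p`, using `C_ℚ/D_ℚ ≅ ∏_p ℤ_pˣ`) is formalized in
  `TateProjectiveLiftingProofs.lean`, `TateUnramifiedLiftingProofs.lean`,
  `LocalKroneckerWeberInertiaProofs.lean` and `TateUnramifiedLiftingReductionProofs.lean`, ending
  in `Tate_projectiveLifting_unramifiedOutside_of_projectiveLifting`; this file feeds it
  `Tate_projectiveLifting_holds`.

## References

* J.-P. Serre, *Modular forms of weight one and Galois representations*, in: Algebraic Number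
  Fields (Durham 1975), Academic Press 1977, §6.1 Thm. 4 (Tate) and Corollary, §6.2 Thm. 5,
  §6.5. [`SerreDurham1977`]
* J. Bosman, *Polynomials for projective representations of level one forms*, in: Computational
  Aspects of Modular Forms and Galois Representations, Ann. of Math. Stud. 176 (2011), Ch. 7,
  Thm. 7.2.2, Lemma 7.2.3. [Bosman2011ProjectivePolynomials]
* D. Harari, *Galois Cohomology and Class Field Theory* (2020), Thm. 14.11 (Brauer–Hasse–Noether).
  [Harari2020]
* J. W. S. Cassels, A. Fröhlich (eds.), *Algebraic Number Theory* (1967), Ch. VII (J. Tate), §9.6,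
  §10. [CasselsFrohlichANT1967]
-/

noncomputable section

namespace Literature.NumberTheory.GaloisRepresentations

open Literature.NumberTheory.GaloisCohomology

/-- **Tate's lifting theorem holds** (Serre, Durham 1977, §6.1, Corollary to Theorem 4 (Tate)):
every projective representation `G_ℚ → PGL_n(k)` with open kernel, over an algebraically closed
field `k` with the discrete topology, has a continuous lifting `G_ℚ → GL_n(k)`.  Discharge of the
named fact `Tate_projectiveLifting`: the tree's `Tate_projectiveLifting_of_brauerHassePrinciple'`
(§6.1 "Thm. 4 ⟹ Cor." and the whole of §6.5, formalized in `TateProjectiveLiftingH2Proofs.lean`,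
`TateH2Vanishing*.lean`, `TateLevelOne*.lean`) fed with the Brauer–Hasse–Noether theorem for the
cyclotomic fields `ℚ(μ_p)`, `p` odd, and `ℚ(i)` (`brauerHassePrinciple_holds`).
[cite: SerreDurham1977, §6.1 Thm. 4 (Tate) and Corollary; §6.5] [cite: Harari2020, Thm. 14.11] -/
theorem Tate_projectiveLifting_holds : Tate_projectiveLifting :=
  Tate_projectiveLifting_of_brauerHassePrinciple'
    (fun p _ _ => brauerHassePrinciple_holds (CyclotomicField p ℚ))
    (brauerHassePrinciple_holds (CyclotomicField 4 ℚ))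

/-- **Tate's lifting theorem with control of ramification holds** (Serre, Durham 1977, §6.2
Thm. 5 together with the Exercise of §6.1; Bosman 2011, Thm. 7.2.2 with Lemma 7.2.3): a projective
representation `ρ̃ : G_ℚ → PGL_n(k)` with open kernel (`k` algebraically closed, discrete), which is
unramified outside a finite set `S` of primes, has a continuous lifting `ρ : G_ℚ → GL_n(k)`
unramified outside `S`.  Discharge of the named fact `Tate_projectiveLifting_unramifiedOutside`:
the printed proof of Thm. 5 (`Tate_projectiveLifting_unramifiedOutside_of_projectiveLifting`,
`TateUnramifiedLiftingReductionProofs.lean`: twist a lifting by a character of `G_ℚ` with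
prescribed restrictions to the inertia groups, built prime by prime from the local Kronecker–Weber
theorem in inertia form) applied to `Tate_projectiveLifting_holds` (§6.1 Cor. to Thm. 4).
[cite: SerreDurham1977, §6.2 Thm. 5 and §6.1 Exercise] [cite: Bosman2011ProjectivePolynomials, Thm. 7.2.2 and Lemma 7.2.3] -/
theorem Tate_projectiveLifting_unramifiedOutside_holds :
    Tate_projectiveLifting_unramifiedOutside :=
  Tate_projectiveLifting_unramifiedOutside_of_projectiveLifting Tate_projectiveLifting_holds

end Literature.NumberTheory.GaloisRepresentations

end
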